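import Summits.ABC.ABC.Theorems.CuspFieldPencilGoldenCuspShadow
import Summits.ABC.ABC.Theorems.CuspFieldPencilGoldenFromNFPencil
import Literature.NumberTheory.DiophantineGeometry.MatveevYuPlaceBoundsNumberField
import Literature.NumberTheory.DiophantineGeometry.AbcTwoAdicValuationProofs
import Literature.IUT.LogVolume.ArakelovDivisors
import HarnessLib

/-!
# STUB-IDEAS `stub_conjugateCuspTriple` — ideator k=2, GEN 9 (FAMILY 2: RESHAPE) — Sketch

Crux `GoldenCuspShadow` (stmt-ABC-26026), route `CuspFieldPencil`. Notation: `Q = u² − 11uw − w²`,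
`R = rad(uwQ)`, `H = max(|u|,|w|)`, `m = min(rad u, rad w)`, `q = rad Q`,
`T = memberT A C u w = A·C^{ω(uw)}·(∏_{p∣uw} log p)·log(2 log H + 3)` (g5/g6/g7's cost unit).

GEN-9 RESHAPE = **ORL-isation of the K-side**.  The ℚ-side of the crux was closed by the LANDED
files A/B/C (p832377 / p832455 / p832548): two "one-ratio lemmas" `orl_arch`, `orl_padic_dvd` over ℤ,
a ℚ-free pre-bound `pre_routeU`, and the fully abstract `endgame_abstract`.  The open K-side
(g7: `fNotSmall` abstract-`K`, `fUpper_fine` abstract-`K`, `normFormSide_one_of_bounds` fresh real analysis)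
is RESHAPED to the same format:

* **the golden ORL interface** (§1): two `Prop`s over ℤ/ℝ only — `GoldenOrlArch`
  (`2 log H ≤ log|Q| + C₀ + 2T`) and `GoldenOrlPadic` (`v_p(Q) log p ≤ T·p/log p` for primes `p ≠ 5`);
  no number field is visible downstream of them;
* **three statement-level simplifications** that shrink the K-side to two M−/S lemmas:
  (S1) `p = 5` needs NO place bound: `v_5(Q) ≤ 3` for coprime `u, w` (F5) — g7 paid `place_cost` there;
  (S2) `v_p(Q) ≤ ord_𝔭(Λ₊) + ord_𝔭(Λ₋)` needs no ramification theory (`p ∈ 𝔭 ⇒ ord_𝔭 p ≥ 1`, units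
  `α₊α₋ = −1`, `ord_𝔭 w = 0` from `gcd(w, Q) = 1`) (V1);
  (S3) the archimedean clause is read MULTIPLICITY-FREE: `log|σ₁Λ| ≥ min(0, mult·log w₁(Λ)) ≥ −T`, so
  neither `IsReal w₁` nor `mult = 1` is ever needed (E2 + H2), and the regime split
  `|u| ≥ 12|w|` (no LFL at all) / `|u| < 12|w|` (one of `Λ±`) is a K-FREE real lemma (A1);
* **the endgame is the landed one**: `PreQ → QSideRad` is a line-by-line clone of the landed
  `routeU_of_engine` with `endgame_abstract` BY NAME (PROVED below), and `PreQ` is assembled from the two ORL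
  Props exactly as the landed `pre_routeU` (P2).

Payoff: `QSideRad` (`log H ≤ κ_δ R^δ·rad Q`, class `q¹`) ⇒ the registered stub (P3, PROVED) AND
`GoldenThird` (`log H ≤ κ R^{1/3+ε}`, P4, PROVED) — modulo the two cite-only NF facts Matveev-2000 / Yu-2007
through g5's `NFPlaceBound`.

Kernel status of THIS file: PROVED — E1, E2, N1, `uwHalf_holds`, `radQ_le_radR`, `qSideRad_of_preQ`,
`min_le_geom`, P3 `stub_of_uwHalf_qSideRad`, P4 `goldenThird_of_qSideRad`, the golden instantiation
`orl_golden`, D1 `absNorm_eq_of_dvd_Q` (g7's degree-one cost, ported) and all compositions.  `sorry` exactly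
in the OPEN helper bodies M1, V1, A1, F5, H1, H2, T1, P1, P2 and the g5-proved port `nfPlaceBound_of_matveev_yu`.
-/

set_option linter.dupNamespace false

noncomputable section

open Real NumberField UniqueFactorizationMonoid Height IsDedekindDomain Finset QuadraticAlgebra
open Literature.NumberTheory.DiophantineGeometry
open Literature.NumberTheory.DiophantineGeometry.Dioph
open Literature.IUT.LogVolume

namespace Summit.ABC.ABC.Cruxes.GoldenCuspShadow.SideaK2G9

/-! ## §0 Statements (verbatim from g7/g8 so that names align) -/

/-- The registered stub `stub_conjugateCuspTriple`, verbatim. -/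
def Sig : Prop :=
  ∀ ε : ℝ, 0 < ε → ∃ κ : ℝ, ∀ u w : ℤ, IsCoprime u w → u * w * (u ^ 2 - 11 * u * w - w ^ 2) ≠ 0 →
    Real.log (max (|(u : ℝ)|) (|(w : ℝ)|)) ≤
      κ * (((UniqueFactorizationMonoid.radical (u * w * (u ^ 2 - 11 * u * w - w ^ 2))).natAbs : ℕ) : ℝ) ^ (ε : ℝ) *
        ((((UniqueFactorizationMonoid.radical (u ^ 2 - 11 * u * w - w ^ 2)).natAbs : ℕ) : ℝ) ^ (2 / 3 : ℝ) *
          (min (((UniqueFactorizationMonoid.radical u).natAbs : ℕ) : ℝ)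
              (((UniqueFactorizationMonoid.radical w).natAbs : ℕ) : ℝ)) ^ (2 / 3 : ℝ))

/-- ℚ-engine output (LANDED: `GoldenCuspShadowBaker.cuspMinRadBound_holds`). -/
def UWHalf : Prop :=
  ∀ δ : ℝ, 0 < δ → ∃ κ : ℝ, ∀ u w : ℤ, IsCoprime u w → u * w * (u ^ 2 - 11 * u * w - w ^ 2) ≠ 0 →
    Real.log (max (|(u : ℝ)|) (|(w : ℝ)|)) ≤
      κ * (((radical (u * w * (u ^ 2 - 11 * u * w - w ^ 2))).natAbs : ℕ) : ℝ) ^ (δ : ℝ) *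
        min (((radical u).natAbs : ℕ) : ℝ) (((radical w).natAbs : ℕ) : ℝ)

/-- FINE K-datum: `log H ≤ κ_δ R^δ · rad(Q)`. -/
def QSideRad : Prop :=
  ∀ δ : ℝ, 0 < δ → ∃ κ : ℝ, ∀ u w : ℤ, IsCoprime u w → u * w * (u ^ 2 - 11 * u * w - w ^ 2) ≠ 0 →
    Real.log (max (|(u : ℝ)|) (|(w : ℝ)|)) ≤
      κ * (((radical (u * w * (u ^ 2 - 11 * u * w - w ^ 2))).natAbs : ℕ) : ℝ) ^ (δ : ℝ) *
        (((radical (u ^ 2 - 11 * u * w - w ^ 2)).natAbs : ℕ) : ℝ)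

/-- Route payoff of the fine road: exponent `1/3`. -/
def GoldenThird : Prop :=
  ∀ ε : ℝ, 0 < ε → ∃ κ : ℝ, ∀ u w : ℤ, IsCoprime u w → u * w * (u ^ 2 - 11 * u * w - w ^ 2) ≠ 0 →
    Real.log (max (|(u : ℝ)|) (|(w : ℝ)|)) ≤
      κ * (((radical (u * w * (u ^ 2 - 11 * u * w - w ^ 2))).natAbs : ℕ) : ℝ) ^ (1 / 3 + ε : ℝ)

/-- g5's shape hypothesis (PROVED there from Matveev-NF ∧ Yu-NF: `SideaK2G5.nfPlaceBound_of_matveev_yu`). -/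
def NFPlaceBound (K : Type) [Field K] [NumberField K] : Prop :=
  ∃ c : ℝ, 1 ≤ c ∧ ∀ (κ : Type) [Fintype κ], 2 ≤ Fintype.card κ →
    ∀ (α : κ → K) (b : κ → ℤ) (B : ℝ),
      (∀ k, α k ≠ 0) → ∏ k, α k ^ b k - 1 ≠ 0 → 3 ≤ B → (∀ k, (|b k| : ℝ) ≤ B) →
      (∀ w : InfinitePlace K,
          -(c ^ Fintype.card κ * (∏ k, max (logHeight₁ (α k)) 1) * Real.log B) <
            (w.mult : ℝ) * Real.log (w (∏ k, α k ^ b k - 1))) ∧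
      (∀ 𝔭 : HeightOneSpectrum (𝓞 K),
          -(c ^ Fintype.card κ *
              ((Ideal.absNorm 𝔭.asIdeal : ℝ) / Real.log (Ideal.absNorm 𝔭.asIdeal : ℝ)) *
              (∏ k, max (logHeight₁ (α k)) 1) * Real.log B) <
            Real.log (NumberField.HeightOneSpectrum.adicAbv K 𝔭 (∏ k, α k ^ b k - 1)))

/-- g5's member error term `T(u,v) = A·C^{ω(uv)}·(∏_{p∣uv} log p)·log(2 log H + 3)` (verbatim). -/
def memberT (A C : ℝ) (u v : ℤ) : ℝ :=
  A * C ^ (u * v).natAbs.primeFactors.card * (∏ p ∈ (u * v).natAbs.primeFactors, Real.log p) *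
    Real.log (2 * Real.log (max (|(u : ℝ)|) (|(v : ℝ)|)) + 3)

/-! ## §1 NEW — the golden ORL interface (ℤ/ℝ only; the number field lives only in its discharge) -/

/-- **I-arch `GoldenOrlArch`.**  `2 log H ≤ log|Q| + C₀ + 2·T(u,w)` for all admissible pairs. -/
def GoldenOrlArch : Prop :=
  ∃ A C C₀ : ℝ, 0 ≤ A ∧ 1 ≤ C ∧ ∀ u w : ℤ, IsCoprime u w → u * w * (u ^ 2 - 11 * u * w - w ^ 2) ≠ 0 →
    2 * Real.log (max (|(u : ℝ)|) (|(w : ℝ)|)) ≤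
      Real.log |((u ^ 2 - 11 * u * w - w ^ 2 : ℤ) : ℝ)| + C₀ + 2 * memberT A C u w

/-- **I-fin `GoldenOrlPadic`.**  At every prime `p ≠ 5` of `Q`: `v_p(Q)·log p ≤ T(u,w)·p/log p`
(the DEGREE-ONE cost; `p = 5` is handled by F5, not by a place bound). -/
def GoldenOrlPadic : Prop :=
  ∃ A C : ℝ, 0 ≤ A ∧ 1 ≤ C ∧ ∀ u w : ℤ, IsCoprime u w → u * w * (u ^ 2 - 11 * u * w - w ^ 2) ≠ 0 →
    ∀ p : ℕ, p.Prime → p ≠ 5 → p ∣ (u ^ 2 - 11 * u * w - w ^ 2).natAbs →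
      (padicValNat p (u ^ 2 - 11 * u * w - w ^ 2).natAbs : ℝ) * Real.log p ≤
        memberT A C u w * ((p : ℝ) / Real.log p)

/-- **PreQ** — the linearised pre-bound, literally the landed `pre_routeU` conclusion with `rad u ↦ rad Q`. -/
def PreQ : Prop :=
  ∀ η : ℝ, 0 < η → ∃ A : ℝ, ∀ u w : ℤ, IsCoprime u w → u * w * (u ^ 2 - 11 * u * w - w ^ 2) ≠ 0 →
    Real.log 13 + 2 * Real.log (max |(u : ℝ)| |(w : ℝ)|) ≤
      A * (((radical (u * w * (u ^ 2 - 11 * u * w - w ^ 2))).natAbs : ℕ) : ℝ) ^ η *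
        (((radical (u ^ 2 - 11 * u * w - w ^ 2)).natAbs : ℕ) : ℝ) *
          Real.log (max (Real.exp 1) (2 * (Real.log 13 + 2 * Real.log (max |(u : ℝ)| |(w : ℝ)|))))

/-! ## §2 The K-side discharge of the interface (any number field `K ∋ θ`, `θ² = θ + 1`)

`α₊ = 3 + 5θ ↦ φ⁵`, `α₋ = 8 − 5θ ↦ −φ⁻⁵` under `θ ↦ φ`; `α₊ + α₋ = 11`, `α₊α₋ = −1` (units);
`Q = (u − α₊w)(u − α₋w)` (tree `GoldenFromNFPencil.formTwo_mul_formThree`: `β₂ = −α₊`, `β₃ = −α₋`);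
MEMBERS `Λ± = u/(α± w) − 1`, so `u − α±w = α±w·Λ±`. -/

/-- **E1 (XS, PROVED).** The real embedding `θ ↦ φ` of `QuadraticAlgebra ℚ 1 1` (`QuadraticAlgebra.lift`, `φ² = φ + 1`). -/
theorem realEmb_exists :
    ∃ σ₁ : QuadraticAlgebra ℚ (1 : ℚ) 1 →+* ℝ, σ₁ QuadraticAlgebra.omega = Real.goldenRatio := by
  have h : Real.goldenRatio * Real.goldenRatio = (1 : ℚ) • (1 : ℝ) + (1 : ℚ) • Real.goldenRatio := by
    rw [one_smul, one_smul]; linear_combination Real.goldenRatio_sq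
  refine ⟨(QuadraticAlgebra.lift ⟨Real.goldenRatio, h⟩).toRingHom, ?_⟩
  simp [QuadraticAlgebra.omega]

/-- **E2 (XS, PROVED).** Reading an infinite place through a real embedding: `w_{σ₁}(x) = |σ₁ x|`. -/
theorem infinitePlace_mk_real_apply (K : Type) [Field K] (σ₁ : K →+* ℝ) (x : K) :
    (NumberField.InfinitePlace.mk ((algebraMap ℝ ℂ).comp σ₁)) x = |σ₁ x| := by
  rw [NumberField.InfinitePlace.apply, RingHom.comp_apply]
  simp

section Golden

variable [Fact (∀ r : ℚ, r ^ 2 ≠ (1 : ℚ) + 1 * r)]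

/-- **N1 (XS, PROVED in g7; copied).** `σ = star` moves `θ = ω` to `1 − θ`. -/
theorem sigma_theta :
    NumberField.RingOfIntegers.mapRingEquiv
        (starRingAut : QuadraticAlgebra ℚ 1 1 ≃+* QuadraticAlgebra ℚ 1 1)
        ⟨ω, Summit.ABC.ABC.Theorems.GoldenField.isIntegral_omega⟩ =
      1 - ⟨ω, Summit.ABC.ABC.Theorems.GoldenField.isIntegral_omega⟩ := by
  apply RingOfIntegers.coe_injective
  simp only [map_sub, map_one]
  rw [show algebraMap (𝓞 (QuadraticAlgebra ℚ 1 1)) (QuadraticAlgebra ℚ 1 1)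
      (RingOfIntegers.mapRingEquiv (starRingAut : QuadraticAlgebra ℚ 1 1 ≃+* QuadraticAlgebra ℚ 1 1)
        ⟨ω, Summit.ABC.ABC.Theorems.GoldenField.isIntegral_omega⟩) =
      starRingAut (ω : QuadraticAlgebra ℚ 1 1) from rfl]
  rw [RingOfIntegers.map_mk]
  ext <;> simp [starRingAut, omega]

end Golden

/-- **M1 `memberBound` (S, OPEN — g5-H2 / g6-H2' verbatim, the ONE K-cost lemma).**  For a fixed
`α₀ ≠ 0` and nonzero coprime `u, v` with `Λ = u/(α₀v) − 1 ≠ 0`: at every infinite place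
`mult·log w(Λ) ≥ −T(u,v)`, at every finite place `ord_𝔭(Λ)·log N𝔭 ≤ T(u,v)·N𝔭/log N𝔭`.
Proof: `NFPlaceBound` on the family `α = (−1, α₀, (p)_{p∣uv})`, `b = (s, −1, (v_p u − v_p v)_p)`
(g6 G1 `famProd`, G2 `castFamily` PROVED; G3 `member_eq_famProd`, G4 `expBound` `|b| ≤ B := 2 log H + 3`,
G5 `heightProduct` `∏ max(h,1) ≤ max(h(α₀),1)·(d/log 2)^{ω}·∏ log p` are XS–S), then G6 `log_adicAbv_eq`
(PROVED) for the finite reading; `A := c²·max(h(α₀),1)·max(h(−1),1)`, `C := c·d/log 2`. -/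
theorem memberBound (K : Type) [Field K] [NumberField K] (hP : NFPlaceBound K) (α₀ : K)
    (hα₀ : α₀ ≠ 0) :
    ∃ A C : ℝ, 0 ≤ A ∧ 1 ≤ C ∧ ∀ u v : ℤ, u ≠ 0 → v ≠ 0 → IsCoprime u v →
      (u : K) / (α₀ * v) - 1 ≠ 0 →
      (∀ w : InfinitePlace K,
          -memberT A C u v ≤ (w.mult : ℝ) * Real.log (w ((u : K) / (α₀ * v) - 1))) ∧
      (∀ 𝔭 : HeightOneSpectrum (𝓞 K),
          (ord K 𝔭 ((u : K) / (α₀ * v) - 1) : ℝ) * Real.log (Ideal.absNorm 𝔭.asIdeal : ℝ) ≤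
            memberT A C u v *
              ((Ideal.absNorm 𝔭.asIdeal : ℝ) / Real.log (Ideal.absNorm 𝔭.asIdeal : ℝ))) := by
  sorry

/-- **V1 `ordQ_le` (S−, OPEN; simplification S2).** At a prime `𝔭 ∋ p`, `p ∣ Q`, `gcd(u,w) = 1`:
both members are nonzero and `v_p(Q) ≤ ord_𝔭(Λ₊) + ord_𝔭(Λ₋)`.
Proof: `p^{v_p Q} ∣ Q` and `ord_𝔭(p) ≥ 1` (`ord_pos_iff_mem`) give `v_p(Q) ≤ ord_𝔭(Q)` (g5 R2
`padicValInt_le_ord`, PROVED there); `Q = (α₊wΛ₊)(α₋wΛ₋)` in `K` (`formTwo_mul_formThree`), `ord_mul`;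
`ord_𝔭(α±) = 0` (`α₊α₋ = −1`, `ord_nonneg_of_isIntegral` twice); `ord_𝔭(w) = 0` (`w ∈ 𝔭 ∋ p` with
`gcd(p,w) = 1` — `p ∣ Q`, `gcd(w,Q) = 1` (`isCoprime_quadForm_right`) — would put `1 ∈ 𝔭`). -/
theorem ordQ_le (K : Type) [Field K] [NumberField K] (θ : K) (hθ : θ * θ = θ + 1)
    (hθi : IsIntegral ℤ θ) {u w : ℤ} (huw : IsCoprime u w)
    (h0 : u * w * (u ^ 2 - 11 * u * w - w ^ 2) ≠ 0) {p : ℕ} (hp : p.Prime)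
    (hpQ : p ∣ (u ^ 2 - 11 * u * w - w ^ 2).natAbs)
    (𝔭 : HeightOneSpectrum (𝓞 K)) (h𝔭 : ((p : ℕ) : 𝓞 K) ∈ 𝔭.asIdeal) :
    (u : K) / ((3 + 5 * θ) * w) - 1 ≠ 0 ∧ (u : K) / ((8 - 5 * θ) * w) - 1 ≠ 0 ∧
    ((padicValNat p (u ^ 2 - 11 * u * w - w ^ 2).natAbs : ℕ) : ℤ) ≤
      ord K 𝔭 ((u : K) / ((3 + 5 * θ) * w) - 1) + ord K 𝔭 ((u : K) / ((8 - 5 * θ) * w) - 1) := by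
  sorry

/-- R0 (g5/g7, PROVED; ported): `N((p)) = p^{[K:ℚ]}`. [folklore] -/
theorem absNorm_span_natCast (K : Type) [Field K] [NumberField K] (p : ℕ) :
    Ideal.absNorm (Ideal.span {((p : ℕ) : 𝓞 K)}) = p ^ Module.finrank ℚ K := by
  rw [Ideal.absNorm_span_singleton]
  have h1 : ((p : ℕ) : 𝓞 K) = algebraMap ℤ (𝓞 K) (p : ℤ) := by simp
  rw [h1, Algebra.norm_algebraMap, NumberField.RingOfIntegers.rank]
  simp [Int.natAbs_pow]

/-- N3 (g7, PROVED; ported): a prime `𝔭 ∋ p` of a quadratic number field has norm `p`, or else it IS `(p)`. -/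
theorem absNorm_eq_or_eq_span (K : Type) [Field K] [NumberField K]
    (hK : Module.finrank ℚ K = 2) {p : ℕ} (hp : p.Prime) (𝔭 : HeightOneSpectrum (𝓞 K))
    (h𝔭 : ((p : ℕ) : 𝓞 K) ∈ 𝔭.asIdeal) :
    Ideal.absNorm 𝔭.asIdeal = p ∨ 𝔭.asIdeal = Ideal.span {((p : ℕ) : 𝓞 K)} := by
  have hle : Ideal.span {((p : ℕ) : 𝓞 K)} ≤ 𝔭.asIdeal := by
    rw [Ideal.span_singleton_le_iff_mem]; exact h𝔭
  have hdvd : Ideal.absNorm 𝔭.asIdeal ∣ p ^ 2 := by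
    rw [← hK, ← absNorm_span_natCast K p]
    exact Ideal.absNorm_dvd_absNorm_of_le hle
  obtain ⟨i, hi, hN⟩ := (Nat.dvd_prime_pow hp).mp hdvd
  have hN1 : (1 : ℕ) < Ideal.absNorm 𝔭.asIdeal := NumberField.HeightOneSpectrum.one_lt_absNorm 𝔭
  interval_cases i
  · rw [pow_zero] at hN; rw [hN] at hN1; exact absurd hN1 (lt_irrefl _)
  · left; rw [hN, pow_one]
  · right
    obtain ⟨J, hJ⟩ := Ideal.dvd_iff_le.mpr hle
    have h := congrArg Ideal.absNorm hJ
    rw [map_mul, absNorm_span_natCast K p, hK, hN] at h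
    have hp2 : p ^ 2 ≠ 0 := pow_ne_zero _ hp.ne_zero
    have hJ1 : Ideal.absNorm J = 1 := by
      have : p ^ 2 * Ideal.absNorm J = p ^ 2 * 1 := by rw [mul_one]; exact h.symm
      exact Nat.eq_of_mul_eq_mul_left (Nat.pos_of_ne_zero hp2) this
    rw [Ideal.absNorm_eq_one_iff] at hJ1
    rw [hJ, hJ1, Ideal.mul_top]

/-- **D1 `absNorm_eq_of_dvd_Q` (S, PROVED — g7's `degOneCost_golden` N5, ported to the unfolded golden form).**
The DEGREE-ONE COST: in a quadratic `K ∋ θ` with an automorphism `σθ = 1 − θ`, for a prime `p ≠ 5` dividing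
a primitive value `Q(u,w)`, EVERY `𝔭 ∋ p` has `N𝔭 = p`.  Ideal-level only: else `𝔭 = (p)` (N3) is
`σ`-stable, `Q = x₂x₃ ∈ 𝔭` puts one and hence (apply `σ`) both conjugate forms in `𝔭`, so `5√5 ∈ 𝔭`
(tree `sqrtFive_mem_sup`), `125 ∈ 𝔭`, `gcd(p,125) = 1 ∈ 𝔭`. -/
theorem absNorm_eq_of_dvd_Q (K : Type) [Field K] [NumberField K] (hK : Module.finrank ℚ K = 2)
    (σ : K ≃+* K) (θ : 𝓞 K) (hθ : θ * θ = θ + 1)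
    (hσ : NumberField.RingOfIntegers.mapRingEquiv σ θ = 1 - θ)
    {p : ℕ} (hp : p.Prime) (hp5 : p ≠ 5) {u w : ℤ} (huw : IsCoprime u w)
    (hpQ : (p : ℤ) ∣ u ^ 2 - 11 * u * w - w ^ 2)
    (𝔭 : HeightOneSpectrum (𝓞 K)) (h𝔭 : ((p : ℕ) : 𝓞 K) ∈ 𝔭.asIdeal) :
    Ideal.absNorm 𝔭.asIdeal = p := by
  rcases absNorm_eq_or_eq_span K hK hp 𝔭 h𝔭 with h | h
  · exact h
  · exfalso
    set τ := NumberField.RingOfIntegers.mapRingEquiv σ with hτ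
    set x₂ : 𝓞 K := (u : 𝓞 K) + (-3 - 5 * θ) * w with hx₂
    set x₃ : 𝓞 K := (u : 𝓞 K) + (-8 + 5 * θ) * w with hx₃
    have hτ₂ : τ x₂ = x₃ := by
      simp only [hx₂, hx₃, map_add, map_sub, map_mul, map_neg, map_intCast, map_ofNat, hσ]; ring
    have hτ₃ : τ x₃ = x₂ := by
      simp only [hx₂, hx₃, map_add, map_mul, map_neg, map_intCast, map_ofNat, hσ]; ring
    have hmap : Ideal.map τ 𝔭.asIdeal = 𝔭.asIdeal := by
      rw [h, Ideal.map_span, Set.image_singleton, map_natCast]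
    have hQmem : x₂ * x₃ ∈ 𝔭.asIdeal := by
      have hprod : x₂ * x₃ = ((u ^ 2 - 11 * u * w - w ^ 2 : ℤ) : 𝓞 K) := by
        have := Summit.ABC.ABC.Theorems.GoldenFromNFPencil.formTwo_mul_formThree θ (u : 𝓞 K) (w : 𝓞 K) hθ
        try simp only [one_mul] at this
        rw [hx₂, hx₃, this]; push_cast; ring
      obtain ⟨m, hm⟩ := hpQ
      have hm' : ((u ^ 2 - 11 * u * w - w ^ 2 : ℤ) : 𝓞 K) = ((p : ℕ) : 𝓞 K) * (m : 𝓞 K) := by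
        rw [hm]; push_cast; ring
      rw [hprod, hm']
      exact Ideal.mul_mem_right _ _ h𝔭
    have hboth : x₂ ∈ 𝔭.asIdeal ∧ x₃ ∈ 𝔭.asIdeal := by
      rcases 𝔭.isPrime.mem_or_mem hQmem with h2 | h3
      · refine ⟨h2, ?_⟩
        have := Ideal.mem_map_of_mem τ h2
        rwa [hmap, hτ₂] at this
      · refine ⟨?_, h3⟩
        have := Ideal.mem_map_of_mem τ h3
        rwa [hmap, hτ₃] at this
    obtain ⟨a, b, hab⟩ := huw
    have hab' : (a : 𝓞 K) * (u : 𝓞 K) + (b : 𝓞 K) * (w : 𝓞 K) = 1 := by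
      rw [← Int.cast_mul, ← Int.cast_mul, ← Int.cast_add, hab, Int.cast_one]
    have hc : (5 * (2 * θ - 1) : 𝓞 K) ∈ Ideal.span {x₂} ⊔ Ideal.span {x₃} := by
      have := Summit.ABC.ABC.Theorems.GoldenFromNFPencil.sqrtFive_mem_sup θ (u : 𝓞 K) (w : 𝓞 K)
        (-3 - 5 * θ) (-8 + 5 * θ) (a : 𝓞 K) (b : 𝓞 K) rfl rfl hab'
      simpa only [hx₂, hx₃, one_mul] using this
    have hc𝔭 : (5 * (2 * θ - 1) : 𝓞 K) ∈ 𝔭.asIdeal := by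
      have hsup : Ideal.span {x₂} ⊔ Ideal.span {x₃} ≤ 𝔭.asIdeal := by
        rw [sup_le_iff, Ideal.span_singleton_le_iff_mem, Ideal.span_singleton_le_iff_mem]
        exact hboth
      exact hsup hc
    have h125 : ((125 : ℕ) : 𝓞 K) ∈ 𝔭.asIdeal := by
      have hsq : (5 * (2 * θ - 1)) * (5 * (2 * θ - 1)) = ((125 : ℕ) : 𝓞 K) := by
        push_cast; linear_combination (100 : 𝓞 K) * hθ
      rw [← hsq]; exact Ideal.mul_mem_left _ _ hc𝔭
    have hcop : Nat.Coprime p 125 := by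
      have : Nat.Coprime p 5 := (Nat.coprime_primes hp Nat.prime_five).mpr hp5
      simpa using this.pow_right 3
    have h1 : (1 : 𝓞 K) ∈ 𝔭.asIdeal := by
      have hz : IsCoprime (p : ℤ) (125 : ℤ) := by exact_mod_cast Nat.Coprime.isCoprime hcop
      obtain ⟨c, d, hcd⟩ := hz
      have : (c : 𝓞 K) * ((p : ℕ) : 𝓞 K) + (d : 𝓞 K) * ((125 : ℕ) : 𝓞 K) = 1 := by
        have := congrArg (fun z : ℤ => (z : 𝓞 K)) hcd
        push_cast at this ⊢; linear_combination this
      rw [← this]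
      exact Ideal.add_mem _ (Ideal.mul_mem_left _ _ h𝔭) (Ideal.mul_mem_left _ _ h125)
    exact 𝔭.isPrime.ne_top ((Ideal.eq_top_iff_one _).mpr h1)

/-- **A1 `arch_split` (S−, OPEN; K-FREE real lemma, simplification S3).**  With `Λ₊ = u/(φ⁵w) − 1`,
`Λ₋ = u/(−φ⁻⁵w) − 1` (`Q = (u − φ⁵w)(u + φ⁻⁵w)` over `ℝ`):
`2 log H ≤ log|Q| + C₀ + max(0, −log|Λ₊|, −log|Λ₋|)`.
Regimes: `|u| ≥ 12|w|` ⇒ `|Q| ≥ (11/144)u²` (no member at all); `|u| < 12|w|` ⇒ `H < 12|w|` and, since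
`(u + φ⁻⁵w) − (u − φ⁵w) = (φ⁵ + φ⁻⁵)w`, one factor has modulus `≥ ((φ⁵+φ⁻⁵)/2)|w|` while the other is
`φ^{±5}|w|·|Λ∓|`; `φ⁵ = 5φ + 3`, `φ⁻⁵ = 5φ − 8` from `Real.goldenRatio_sq`. -/
theorem arch_split : ∃ C₀ : ℝ, ∀ u w : ℝ, w ≠ 0 → u ^ 2 - 11 * u * w - w ^ 2 ≠ 0 →
    2 * Real.log (max |u| |w|) ≤ Real.log |u ^ 2 - 11 * u * w - w ^ 2| + C₀ +
      max 0 (max (-Real.log |u / (Real.goldenRatio ^ 5 * w) - 1|)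
        (-Real.log |u / (-(Real.goldenRatio ^ 5)⁻¹ * w) - 1|)) := by
  sorry

/-- **F5 `padicValNat_five_le` (S−, OPEN; simplification S1).**  `v_5(Q) ∈ {0, 2, 3}` for coprime `u, w`:
`5 ∣ Q ⇔ w ≡ 2u (5)`; with `w = 2u + 5t`, `Q = −25(u² + 3ut + t²)`, `u² + 3ut + t² ≡ (u − t)² (5)`, and if
`t = u + 5s` then `u² + 3ut + t² = 5(u² + 5us + 5s²)` with `5 ∤ u` (else `5 ∣ w`).  (`ZMod 125`/`decide` also works.) -/
theorem padicValNat_five_le {u w : ℤ} (huw : IsCoprime u w) (hQ : u ^ 2 - 11 * u * w - w ^ 2 ≠ 0) :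
    padicValNat 5 (u ^ 2 - 11 * u * w - w ^ 2).natAbs ≤ 3 := by
  sorry

/-- **H1 `goldenOrlPadic_of_nfPlaceBound` (S−, OPEN; assembly of M1 ×2, V1, D1, g5-R1 `exists_prime_over`).**
Per prime `p ≠ 5` of `Q`: pick `𝔭 ∋ p`; `v_p(Q) log p ≤ (ord Λ₊ + ord Λ₋)·log N𝔭` (V1, `log p = log N𝔭` by D1)
`≤ (T₊ + T₋)·N𝔭/log N𝔭 = (T₊ + T₋)·p/log p` (M1 at `α₀ = α₊, α₋`; D1); `T₊ + T₋ ≤ 2·T_{max A, max C}`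
(monotonicity of `memberT` in `A ≥ 0`, `C ≥ 1`), fold `2` into `A`. -/
theorem goldenOrlPadic_of_nfPlaceBound (K : Type) [Field K] [NumberField K] (hP : NFPlaceBound K)
    (hK : Module.finrank ℚ K = 2) (σ : K ≃+* K) (θ : 𝓞 K) (hθ : θ * θ = θ + 1)
    (hσ : NumberField.RingOfIntegers.mapRingEquiv σ θ = 1 - θ) : GoldenOrlPadic := by
  sorry

/-- **H2 `goldenOrlArch_of_nfPlaceBound` (S, OPEN; assembly of M1 ×2 (infinite clause), E2, A1).**
At `w₁ := InfinitePlace.mk((algebraMap ℝ ℂ) ∘ σ₁)`: `w₁(Λ±) = |σ₁Λ±|` (E2) with `σ₁Λ₊ = u/(φ⁵w) − 1`,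
`σ₁Λ₋ = u/(−φ⁻⁵w) − 1` (`σ₁(3+5θ) = 5φ+3 = φ⁵`, `σ₁(8−5θ) = 8−5φ = −φ⁻⁵`); multiplicity-free reading
`log|σ₁Λ| ≥ min(0, mult·log w₁ Λ) ≥ −T` (`T ≥ 0`); then A1 and `max(T₊,T₋) ≤ T_{max A, max C}`. -/
theorem goldenOrlArch_of_nfPlaceBound (K : Type) [Field K] [NumberField K] (hP : NFPlaceBound K)
    (θ : K) (hθ : θ * θ = θ + 1) (σ₁ : K →+* ℝ) (hσ₁ : σ₁ θ = Real.goldenRatio) : GoldenOrlArch := by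
  sorry

/-! ## §3 The ℚ-free endgame — clones of the LANDED `pre_routeU` / `routeU_of_engine` -/

/-- **T1 `memberT_le` (S−, OPEN; the analogue of the landed `theta_call_le`).**
`T(u,w) ≤ C'·R^η·log max(e, 2(log 13 + 2 log H))`: `C^{ω(uw)} ≤ C₁·rad(uw)^{η/2}`
(`exists_pow_card_primeFactors_le_mul_rpow`), `∏_{p∣uw} log p ≤ C₂·rad(uw)^{η/2}`
(`exists_prod_log_primeFactors_le_mul_rpow`), `∏_{p∣uw} p = rad(uw) ≤ R` (`natAbs_radical_cast`, `radR_prod`,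
`one_le_radR`), `log(2 log H + 3) ≤ log max(e, 2 log 13 + 4 log H)` (`2 log 13 ≥ 3`). -/
theorem memberT_le {A C : ℝ} (hA : 0 ≤ A) (hC : 1 ≤ C) {η : ℝ} (hη : 0 < η) :
    ∃ C' : ℝ, 0 ≤ C' ∧ ∀ u w : ℤ, IsCoprime u w → u * w * (u ^ 2 - 11 * u * w - w ^ 2) ≠ 0 →
      memberT A C u w ≤
        C' * (((radical (u * w * (u ^ 2 - 11 * u * w - w ^ 2))).natAbs : ℕ) : ℝ) ^ η *
          Real.log (max (Real.exp 1) (2 * (Real.log 13 + 2 * Real.log (max |(u : ℝ)| |(w : ℝ)|)))) := by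
  sorry

/-- **P1 `logQ_le_of_orlPadic` (S−, OPEN; the analogue of the landed `cusp_padic` summed).**
`log|Q| = Σ_{p∣Q} v_p(Q) log p` (`Nat.factorization`/`Real.log` of a product) `≤ 3 log 5 + T·Σ_{p∣Q} p/log p`
(F5 at `p = 5`, `GoldenOrlPadic` elsewhere) `≤ 3 log 5 + T·(4/(3 log 2))·rad Q` (`1 + 3Σ_{p∣n} p ≤ 4 rad n`:
landed `one_add_three_sum_le`). -/
theorem logQ_le_of_orlPadic (h : GoldenOrlPadic) :
    ∃ A C C₁ C₂ : ℝ, 0 ≤ A ∧ 1 ≤ C ∧ 0 ≤ C₂ ∧ ∀ u w : ℤ, IsCoprime u w →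
      u * w * (u ^ 2 - 11 * u * w - w ^ 2) ≠ 0 →
      Real.log |((u ^ 2 - 11 * u * w - w ^ 2 : ℤ) : ℝ)| ≤
        C₁ + C₂ * memberT A C u w * (((radical (u ^ 2 - 11 * u * w - w ^ 2)).natAbs : ℕ) : ℝ) := by
  sorry

/-- **P2 `preQ_of_orl` (S, OPEN; clone of the landed `pre_routeU`, D5 of file C).**
`y := log 13 + 2 log H ≤ log 13 + (log|Q| + C₀ + 2T)` (I-arch) `≤ const + (2 + C₂ q)·T'` (P1, both `T`s
dominated by `T' = memberT (max A) (max C)`), `T' ≤ C' R^η L` (T1), and every additive constant is absorbed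
by `R^η·q·L ≥ 1` exactly as in `pre_routeU`. -/
theorem preQ_of_orl (hA : GoldenOrlArch) (hF : GoldenOrlPadic) : PreQ := by
  sorry

/-- `rad Q ≤ rad(uwQ)` (bookkeeping for `endgame_abstract`; PROVED). -/
theorem radQ_le_radR {u w : ℤ} (h : IsCoprime u w) :
    (((radical (u ^ 2 - 11 * u * w - w ^ 2)).natAbs : ℕ) : ℝ) ≤
      (((radical (u * w * (u ^ 2 - 11 * u * w - w ^ 2))).natAbs : ℕ) : ℝ) := by
  have hprod := Summit.ABC.ABC.Theorems.GoldenCuspShadowBaker.radR_prod h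
  have ha := Summit.ABC.ABC.Theorems.GoldenCuspShadowBaker.one_le_radR u
  have hb := Summit.ABC.ABC.Theorems.GoldenCuspShadowBaker.one_le_radR w
  have hq : 0 ≤ (((radical (u ^ 2 - 11 * u * w - w ^ 2)).natAbs : ℕ) : ℝ) := Nat.cast_nonneg _
  have hab : (1 : ℝ) * 1 ≤ (((radical u).natAbs : ℕ) : ℝ) * (((radical w).natAbs : ℕ) : ℝ) :=
    mul_le_mul ha hb zero_le_one (zero_le_one.trans ha)
  calc (((radical (u ^ 2 - 11 * u * w - w ^ 2)).natAbs : ℕ) : ℝ)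
      = (1 : ℝ) * 1 * (((radical (u ^ 2 - 11 * u * w - w ^ 2)).natAbs : ℕ) : ℝ) := by ring
    _ ≤ (((radical u).natAbs : ℕ) : ℝ) * (((radical w).natAbs : ℕ) : ℝ) *
          (((radical (u ^ 2 - 11 * u * w - w ^ 2)).natAbs : ℕ) : ℝ) := mul_le_mul_of_nonneg_right hab hq
    _ = _ := hprod.symm

/-- **E `qSideRad_of_preQ` (S, PROVED — line-by-line clone of the landed `routeU_of_engine`, with the landed
`endgame_abstract` BY NAME on the index type of admissible pairs, `m := rad Q ≤ R`).** -/
theorem qSideRad_of_preQ (hpre : PreQ) : QSideRad := by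
  have main := @Summit.ABC.ABC.Theorems.GoldenCuspShadowBaker.endgame_abstract
    {p : ℤ × ℤ // IsCoprime p.1 p.2 ∧ p.1 * p.2 * (p.1 ^ 2 - 11 * p.1 * p.2 - p.2 ^ 2) ≠ 0}
    (fun i => Real.log 13 + 2 * Real.log ((max |(i.1.1 : ℝ)| |(i.1.2 : ℝ)|)))
    (fun i => (((radical (i.1.1 * i.1.2 * (i.1.1 ^ 2 - 11 * i.1.1 * i.1.2 - i.1.2 ^ 2))).natAbs : ℕ) : ℝ))
    (fun i => (((radical (i.1.1 ^ 2 - 11 * i.1.1 * i.1.2 - i.1.2 ^ 2)).natAbs : ℕ) : ℝ))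
    (fun i => Summit.ABC.ABC.Theorems.GoldenCuspShadowBaker.one_le_radR _)
    (fun i => Summit.ABC.ABC.Theorems.GoldenCuspShadowBaker.one_le_radR _)
    (fun i => radQ_le_radR i.2.1)
    (fun η hη => by
      obtain ⟨A, hA⟩ := hpre η hη
      exact ⟨A, fun i => hA i.1.1 i.1.2 i.2.1 i.2.2⟩)
  intro ε hε
  obtain ⟨κ, hκ⟩ := main ε hε
  refine ⟨max κ 0, fun u w h h0 => ?_⟩
  set Rr : ℝ := (((radical (u * w * (u ^ 2 - 11 * u * w - w ^ 2))).natAbs : ℕ) : ℝ) with hRr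
  have key : Real.log 13 + 2 * Real.log ((max |(u : ℝ)| |(w : ℝ)|)) ≤
      κ * Rr ^ ε * (((radical (u ^ 2 - 11 * u * w - w ^ 2)).natAbs : ℕ) : ℝ) := hκ ⟨(u, w), h, h0⟩
  have hu : u ≠ 0 := by rintro rfl; simp at h0
  have hH1 : 1 ≤ (max |(u : ℝ)| |(w : ℝ)|) := by
    have : (1 : ℝ) ≤ |(u : ℝ)| := by exact_mod_cast Int.one_le_abs hu
    exact this.trans (le_max_left _ _)
  have hlogH : 0 ≤ Real.log ((max |(u : ℝ)| |(w : ℝ)|)) := Real.log_nonneg hH1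
  have h13 : 0 ≤ Real.log 13 := Real.log_nonneg (by norm_num)
  have hRε : 0 ≤ Rr ^ ε := Real.rpow_nonneg (Nat.cast_nonneg _) _
  have hq0 : 0 ≤ (((radical (u ^ 2 - 11 * u * w - w ^ 2)).natAbs : ℕ) : ℝ) := Nat.cast_nonneg _
  have step : κ * Rr ^ ε * (((radical (u ^ 2 - 11 * u * w - w ^ 2)).natAbs : ℕ) : ℝ) ≤
      max κ 0 * Rr ^ ε * (((radical (u ^ 2 - 11 * u * w - w ^ 2)).natAbs : ℕ) : ℝ) :=
    mul_le_mul_of_nonneg_right (mul_le_mul_of_nonneg_right (le_max_left _ _) hRε) hq0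
  have hfin : Real.log ((max |(u : ℝ)| |(w : ℝ)|)) ≤
      max κ 0 * Rr ^ ε * (((radical (u ^ 2 - 11 * u * w - w ^ 2)).natAbs : ℕ) : ℝ) := by
    linarith
  simpa [hRr] using hfin

/-! ## §4 The golden instantiation and the payoff (PROVED) -/

/-- **G `orl_golden` (S−, PROVED modulo H1/H2).**  At `K = QuadraticAlgebra ℚ 1 1`: `θ = ⟨ω, isIntegral_omega⟩`
(`theta_mul_theta`), `σ = starRingAut` (N1), `σ₁` from E1, `finrank = 2` (`GoldenField.finrank_eq_two`). -/
theorem orl_golden (hP : ∀ (K : Type) [Field K] [NumberField K], NFPlaceBound K) :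
    GoldenOrlArch ∧ GoldenOrlPadic := by
  haveI hfact : Fact (∀ r : ℚ, r ^ 2 ≠ (1 : ℚ) + 1 * r) :=
    ⟨Summit.ABC.ABC.Theorems.GoldenField.golden_fact⟩
  haveI : NumberField (QuadraticAlgebra ℚ (1 : ℚ) 1) :=
    Summit.ABC.ABC.Theorems.GoldenField.numberField
  obtain ⟨θ, hθdef⟩ : ∃ θ : 𝓞 (QuadraticAlgebra ℚ (1 : ℚ) 1),
      θ = ⟨QuadraticAlgebra.omega, Summit.ABC.ABC.Theorems.GoldenField.isIntegral_omega⟩ := ⟨_, rfl⟩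
  have hθ : θ * θ = θ + 1 := by
    rw [hθdef]; exact Summit.ABC.ABC.Theorems.GoldenFromNFPencil.theta_mul_theta
  have hθK : (θ : QuadraticAlgebra ℚ (1 : ℚ) 1) * θ = θ + 1 := by
    have h := congrArg (algebraMap (𝓞 (QuadraticAlgebra ℚ (1 : ℚ) 1)) (QuadraticAlgebra ℚ (1 : ℚ) 1)) hθ
    simpa using h
  have hσ : NumberField.RingOfIntegers.mapRingEquiv
      (starRingAut : QuadraticAlgebra ℚ (1 : ℚ) 1 ≃+* QuadraticAlgebra ℚ (1 : ℚ) 1) θ = 1 - θ := by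
    rw [hθdef]; exact sigma_theta
  have hfin : Module.finrank ℚ (QuadraticAlgebra ℚ (1 : ℚ) 1) = 2 :=
    Summit.ABC.ABC.Theorems.GoldenField.finrank_eq_two
  obtain ⟨σ₁, hσ₁⟩ := realEmb_exists
  have hσ₁' : σ₁ (θ : QuadraticAlgebra ℚ (1 : ℚ) 1) = Real.goldenRatio := by
    rw [hθdef]; exact hσ₁
  exact ⟨goldenOrlArch_of_nfPlaceBound _ (hP _) (θ : QuadraticAlgebra ℚ (1 : ℚ) 1) hθK σ₁ hσ₁',
    goldenOrlPadic_of_nfPlaceBound _ (hP _) hfin starRingAut θ hθ hσ⟩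

/-- `UWHalf` is the landed min-form (PROVED, by name). -/
theorem uwHalf_holds : UWHalf :=
  Summit.ABC.ABC.Theorems.GoldenCuspShadowBaker.cuspMinRadBound_holds

/-- `min a b ≤ a^s b^t` for `s + t = 1` (g5/g6/g7, PROVED; ported). -/
theorem min_le_geom {a b s t : ℝ} (ha : 0 ≤ a) (hb : 0 ≤ b) (hs : 0 ≤ s) (ht : 0 ≤ t)
    (hst : s + t = 1) : min a b ≤ a ^ s * b ^ t := by
  have hm0 : 0 ≤ min a b := le_min ha hb
  have hsplit : min a b = (min a b) ^ s * (min a b) ^ t := by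
    rw [← Real.rpow_add' hm0 (by rw [hst]; norm_num), hst, Real.rpow_one]
  rw [hsplit]
  exact mul_le_mul (Real.rpow_le_rpow hm0 (min_le_left a b) hs)
    (Real.rpow_le_rpow hm0 (min_le_right a b) ht) (Real.rpow_nonneg hm0 t) (Real.rpow_nonneg ha s)

/-- **P3 `stub_of_uwHalf_qSideRad` (S−, PROVED — g7 verbatim).** `min(m, q) ≤ m^{2/3} q^{1/3} ≤ m^{2/3} q^{2/3}`. -/
theorem stub_of_uwHalf_qSideRad (h1 : UWHalf) (h2 : QSideRad) : Sig := by
  intro ε hε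
  obtain ⟨κ₁, hκ₁⟩ := h1 ε hε
  obtain ⟨κ₂, hκ₂⟩ := h2 ε hε
  refine ⟨max (max κ₁ κ₂) 0, fun u w huw h0 => ?_⟩
  have hA := hκ₁ u w huw h0
  have hB := hκ₂ u w huw h0
  have hq01 : (((radical (u ^ 2 - 11 * u * w - w ^ 2)).natAbs : ℕ) : ℝ) = 0 ∨
      1 ≤ (((radical (u ^ 2 - 11 * u * w - w ^ 2)).natAbs : ℕ) : ℝ) := by
    rcases Nat.eq_zero_or_pos ((radical (u ^ 2 - 11 * u * w - w ^ 2)).natAbs) with h | h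
    · left; rw [h]; simp
    · right; exact_mod_cast h
  generalize hR : (((radical (u * w * (u ^ 2 - 11 * u * w - w ^ 2))).natAbs : ℕ) : ℝ) = R at *
  generalize hq : (((radical (u ^ 2 - 11 * u * w - w ^ 2)).natAbs : ℕ) : ℝ) = q at *
  generalize ha : (((radical u).natAbs : ℕ) : ℝ) = a at *
  generalize hb : (((radical w).natAbs : ℕ) : ℝ) = b at *
  generalize hL : Real.log (max (|(u : ℝ)|) (|(w : ℝ)|)) = L at *
  have hR0 : 0 ≤ R := by rw [← hR]; exact Nat.cast_nonneg _
  have hq0 : 0 ≤ q := by rw [← hq]; exact Nat.cast_nonneg _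
  have ha0 : 0 ≤ a := by rw [← ha]; exact Nat.cast_nonneg _
  have hb0 : 0 ≤ b := by rw [← hb]; exact Nat.cast_nonneg _
  have hm0 : 0 ≤ min a b := le_min ha0 hb0
  have hRe : 0 ≤ R ^ (ε : ℝ) := Real.rpow_nonneg hR0 _
  set κ : ℝ := max (max κ₁ κ₂) 0 with hκ
  have hκ0 : 0 ≤ κ := le_max_right _ _
  have hκR : 0 ≤ κ * R ^ (ε : ℝ) := mul_nonneg hκ0 hRe
  have hA' : L ≤ κ * R ^ (ε : ℝ) * min a b :=
    hA.trans (mul_le_mul_of_nonneg_right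
      (mul_le_mul_of_nonneg_right ((le_max_left κ₁ κ₂).trans (le_max_left (max κ₁ κ₂) 0)) hRe) hm0)
  have hB' : L ≤ κ * R ^ (ε : ℝ) * q :=
    hB.trans (mul_le_mul_of_nonneg_right
      (mul_le_mul_of_nonneg_right ((le_max_right κ₁ κ₂).trans (le_max_left (max κ₁ κ₂) 0)) hRe) hq0)
  have hmin : L ≤ κ * R ^ (ε : ℝ) * min (min a b) q := by
    rcases le_total (min a b) q with h | h
    · rw [min_eq_left h]; exact hA'
    · rw [min_eq_right h]; exact hB'
  have hgeom : min (min a b) q ≤ (min a b) ^ (2 / 3 : ℝ) * q ^ (1 / 3 : ℝ) :=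
    min_le_geom hm0 hq0 (by norm_num) (by norm_num) (by norm_num)
  have hq13 : q ^ (1 / 3 : ℝ) ≤ q ^ (2 / 3 : ℝ) := by
    rcases hq01 with h | h
    · rw [h, Real.zero_rpow (by norm_num), Real.zero_rpow (by norm_num)]
    · exact Real.rpow_le_rpow_of_exponent_le h (by norm_num)
  have hm23 : 0 ≤ (min a b) ^ (2 / 3 : ℝ) := Real.rpow_nonneg hm0 _
  calc L ≤ κ * R ^ (ε : ℝ) * min (min a b) q := hmin
    _ ≤ κ * R ^ (ε : ℝ) * ((min a b) ^ (2 / 3 : ℝ) * q ^ (1 / 3 : ℝ)) :=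
        mul_le_mul_of_nonneg_left hgeom hκR
    _ ≤ κ * R ^ (ε : ℝ) * ((min a b) ^ (2 / 3 : ℝ) * q ^ (2 / 3 : ℝ)) :=
        mul_le_mul_of_nonneg_left (mul_le_mul_of_nonneg_left hq13 hm23) hκR
    _ = κ * R ^ (ε : ℝ) * (q ^ (2 / 3 : ℝ) * (min a b) ^ (2 / 3 : ℝ)) := by ring

/-- **P4 `goldenThird_of_qSideRad` (S−, PROVED — g8 verbatim).** `min(m, q) ≤ (m²q)^{1/3} ≤ R^{1/3}`. -/
theorem goldenThird_of_qSideRad (hC : UWHalf) (hQ : QSideRad) : GoldenThird := by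
  intro ε hε
  obtain ⟨κ₁, h₁⟩ := hC ε hε
  obtain ⟨κ₂, h₂⟩ := hQ ε hε
  refine ⟨max (max κ₁ κ₂) 0, fun u w h h0 => ?_⟩
  set a : ℝ := (((radical u).natAbs : ℕ) : ℝ) with hadef
  set b : ℝ := (((radical w).natAbs : ℕ) : ℝ) with hbdef
  set q : ℝ := (((radical (u ^ 2 - 11 * u * w - w ^ 2)).natAbs : ℕ) : ℝ) with hqdef
  set R : ℝ := (((radical (u * w * (u ^ 2 - 11 * u * w - w ^ 2))).natAbs : ℕ) : ℝ) with hRdef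
  set m : ℝ := min a b with hmdef
  set K : ℝ := max (max κ₁ κ₂) 0 with hKdef
  have ha0 : 0 ≤ a := Nat.cast_nonneg _
  have hb0 : 0 ≤ b := Nat.cast_nonneg _
  have hq0 : 0 ≤ q := Nat.cast_nonneg _
  have hR1 : 1 ≤ R := Summit.ABC.ABC.Theorems.GoldenCuspShadowBaker.one_le_radR _
  have hR0 : 0 < R := by linarith
  have hm0 : 0 ≤ m := le_min ha0 hb0
  have hRabq : R = a * b * q := by
    rw [hRdef, hadef, hbdef, hqdef, Summit.ABC.ABC.Theorems.GoldenFromNFPencil.natAbs_radical_prod h]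
    push_cast; ring
  have hK0 : 0 ≤ K := le_max_right _ _
  have hk₁ : κ₁ ≤ K := (le_max_left _ _).trans (le_max_left _ _)
  have hk₂ : κ₂ ≤ K := (le_max_right _ _).trans (le_max_left _ _)
  have hRε : 0 ≤ R ^ (ε : ℝ) := Real.rpow_nonneg hR0.le _
  have A : Real.log (max |(u : ℝ)| |(w : ℝ)|) ≤ K * R ^ (ε : ℝ) * m :=
    (h₁ u w h h0).trans (mul_le_mul_of_nonneg_right (mul_le_mul_of_nonneg_right hk₁ hRε) hm0)
  have B : Real.log (max |(u : ℝ)| |(w : ℝ)|) ≤ K * R ^ (ε : ℝ) * q :=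
    (h₂ u w h h0).trans (mul_le_mul_of_nonneg_right (mul_le_mul_of_nonneg_right hk₂ hRε) hq0)
  have C : Real.log (max |(u : ℝ)| |(w : ℝ)|) ≤ K * R ^ (ε : ℝ) * min m q := by
    rcases min_choice m q with hmin | hmin <;> rw [hmin]
    · exact A
    · exact B
  have hm2q : m ^ 2 * q ≤ R := by
    rw [hRabq]
    have : m ^ 2 ≤ a * b := by
      rw [sq]; exact mul_le_mul (min_le_left _ _) (min_le_right _ _) hm0 ha0
    exact mul_le_mul_of_nonneg_right this hq0
  have hstep : min m q ≤ R ^ (1 / 3 : ℝ) := by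
    calc min m q ≤ m ^ (2 / 3 : ℝ) * q ^ (1 / 3 : ℝ) :=
          min_le_geom hm0 hq0 (by norm_num) (by norm_num) (by norm_num)
      _ = (m ^ 2 * q) ^ (1 / 3 : ℝ) := by
          rw [Real.mul_rpow (pow_nonneg hm0 2) hq0, show m ^ 2 = m ^ (2 : ℝ) by norm_cast,
            ← Real.rpow_mul hm0]
          norm_num
      _ ≤ R ^ (1 / 3 : ℝ) := Real.rpow_le_rpow (by positivity) hm2q (by norm_num)
  have hfinal : K * R ^ (ε : ℝ) * min m q ≤ K * R ^ (1 / 3 + ε : ℝ) := by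
    calc K * R ^ (ε : ℝ) * min m q ≤ K * R ^ (ε : ℝ) * R ^ (1 / 3 : ℝ) :=
          mul_le_mul_of_nonneg_left hstep (mul_nonneg hK0 hRε)
      _ = K * R ^ (1 / 3 + ε : ℝ) := by
          rw [mul_assoc, ← Real.rpow_add hR0, add_comm]
  exact C.trans hfinal

/-- **g5-H1 (S, PROVED in g5 `SideaK2G5.nfPlaceBound_of_matveev_yu`; port verbatim).** -/
theorem nfPlaceBound_of_matveev_yu (hM : matveev2000_linearFormsLog_nf)
    (hY : yu2007_padicLogForm_logB_nf) (K : Type) [Field K] [NumberField K] : NFPlaceBound K := by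
  sorry

/-! ## §5 Compositions (kernel-checked modulo the `sorry`s above) -/

/-- `QSideRad` from the place-bound shape hypothesis. -/
theorem qSideRad_of_nfPlaceBound (hP : ∀ (K : Type) [Field K] [NumberField K], NFPlaceBound K) :
    QSideRad :=
  qSideRad_of_preQ (preQ_of_orl (orl_golden hP).1 (orl_golden hP).2)

/-- The registered stub from the shape hypothesis. -/
theorem sig_of_nfPlaceBound (hP : ∀ (K : Type) [Field K] [NumberField K], NFPlaceBound K) : Sig :=
  stub_of_uwHalf_qSideRad uwHalf_holds (qSideRad_of_nfPlaceBound hP)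

/-- The exponent-`1/3` payoff from the shape hypothesis. -/
theorem goldenThird_of_nfPlaceBound (hP : ∀ (K : Type) [Field K] [NumberField K], NFPlaceBound K) :
    GoldenThird :=
  goldenThird_of_qSideRad uwHalf_holds (qSideRad_of_nfPlaceBound hP)

/-- The registered stub from the two cite-only number-field facts (Matveev 2000, Yu 2007). -/
theorem sig_of_matveev_yu (hM : matveev2000_linearFormsLog_nf) (hY : yu2007_padicLogForm_logB_nf) : Sig :=
  sig_of_nfPlaceBound (fun K _ _ => nfPlaceBound_of_matveev_yu hM hY K)

/-- `GoldenThird` from the two cite-only number-field facts. -/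
theorem goldenThird_of_matveev_yu (hM : matveev2000_linearFormsLog_nf)
    (hY : yu2007_padicLogForm_logB_nf) : GoldenThird :=
  goldenThird_of_nfPlaceBound (fun K _ _ => nfPlaceBound_of_matveev_yu hM hY K)

/-- Sanity: `Sig` is literally the registered signature. -/
example (h : Sig) : ∀ ε : ℝ, 0 < ε → ∃ κ : ℝ, ∀ u w : ℤ, IsCoprime u w → u * w * (u ^ 2 - 11 * u * w - w ^ 2) ≠ 0 → Real.log (max (|(u : ℝ)|) (|(w : ℝ)|)) ≤ κ * (((UniqueFactorizationMonoid.radical (u * w * (u ^ 2 - 11 * u * w - w ^ 2))).natAbs : ℕ) : ℝ) ^ (ε : ℝ) * ((((UniqueFactorizationMonoid.radical (u ^ 2 - 11 * u * w - w ^ 2)).natAbs : ℕ) : ℝ) ^ (2 / 3 : ℝ) * (min (((UniqueFactorizationMonoid.radical u).natAbs : ℕ) : ℝ) (((UniqueFactorizationMonoid.radical w).natAbs : ℕ) : ℝ)) ^ (2 / 3 : ℝ)) :=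
  h

end Summit.ABC.ABC.Cruxes.GoldenCuspShadow.SideaK2G9

end
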